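import Literature.AlgebraicGeometry.Resolution.ConjugateDiscs
import Mathlib.RingTheory.Valuation.LocalSubring
import HarnessLib

/-!
# The conjugate-discs estimate, II: integrality over the `k`-rational model

Topic: `Literature/AlgebraicGeometry/Resolution` (valued function fields; models of discs over
valuation rings). Continuation of `ConjugateDiscs.lean` (M. Temkin, *Inseparable local
uniformization*, arXiv:0804.1554v3, proof of Thm. 3.3.1, Step 3: the `K`-rational algebraization
of an `m`-disc). With the estimate of that file holding for EVERY valuation, the separating
function `b(x) = ∏_{far}(x − aᵢ)/(a − aᵢ)` and the disc coordinate `b(x)(x − a)/c` lie in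
every valuation ring `W` of the ambient field containing a model ring `B` (`B ⊇ m°`, `x ∈ B`,
and the `k`-rational function `g = Q(x)^e / c′ ∈ B`, `Q(x) = ∏ᵢ (x − aᵢ)`), hence — the
intersection of the valuation overrings being the integral closure
(Mathlib's `iInf_valuationSubring_superset`) — are INTEGRAL over `B`:

* `mem_valuationSubring_of_model` — for every valuation subring `W ⊇ B`: `b(x) ∈ W` and
  `b(x)(x − a)/c ∈ W`. Two cases: if `W` contains a constant outside `m°` then, `m°` being of
  height one (rendered by the archimedean property `hArch`), `W ⊇ m` and both elements are
  visibly in `W`; otherwise `W ∩ m = m°`, `W` induces on the constants the order of `m°`, the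
  near/far partition and the `Q`-bound transfer from the valuation of the point to `W`, and the
  estimate of `ConjugateDiscs.lean` applies — PROVED;
* `isIntegral_conjProd_of_model`, `isIntegral_conjProd_mul_of_model` — integrality over `B` —
  PROVED.

All statements are [folklore]; no named facts.

## Sources

* M. Temkin, arXiv:0804.1554v3, proof of Thm. 3.3.1, Step 3, p. 45 (the use);
  O. Zariski, P. Samuel, *Commutative Algebra* II, VI §4 Thm. 6 (integral closure = intersection
  of valuation rings), through Mathlib.
-/

open scoped BigOperators

namespace Literature.AlgebraicGeometry.Resolution

namespace ConjugateDiscs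

variable {Ω : Type*} [Field Ω] (V : ValuationSubring Ω) (M : Subfield Ω)
  {I : Type*} [Fintype I] (a : I → Ω) (i₀ : I) (cγ : Ω)

/-- The `k`-rational normalizer `c′ = (c^{#near} · ∏_{far} (aᵢ − a))^e` of `Q(x)^e`, with near/far
measured by the valuation of the point. [folklore] -/
noncomputable def cNorm (e : ℕ) : Ω :=
  (cγ ^ (near V.valuation a i₀ (V.valuation cγ)).card *
    ∏ i ∈ far V.valuation a i₀ (V.valuation cγ), (a i - a i₀)) ^ e

variable {V M a i₀ cγ}

/-- Two valuation subrings with the same trace on the constants induce the same order on them.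
[folklore] -/
theorem valuation_le_iff_of_trace_eq {W : ValuationSubring Ω}
    (htr : ∀ μ ∈ M, μ ∈ W ↔ μ ∈ V) {μ ν : Ω} (hμ : μ ∈ M) (hν : ν ∈ M) :
    W.valuation μ ≤ W.valuation ν ↔ V.valuation μ ≤ V.valuation ν := by
  rcases eq_or_ne ν 0 with rfl | hν0
  · simp
  · have key : ∀ U : ValuationSubring Ω, U.valuation μ ≤ U.valuation ν ↔ μ / ν ∈ U := by
      intro U
      rw [← U.valuation_le_one_iff, map_div₀, div_le_one₀]
      exact (U.valuation.pos_iff).mpr hν0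
    rw [key W, key V]
    exact htr _ (M.div_mem hμ hν)

variable (V M a i₀ cγ)

/-- **The separating function and the disc coordinate lie in every valuation ring containing a
model.** Setting: `V` the valuation ring of the point on the ambient field, `M` the constant
field, with `M ∩ V` of height one (archimedean: `hArch`); a model ring `B ⊇ M ∩ V` containing
`x` and the `k`-rational function `g` with `g · c′ = Q(x)^e`. [folklore] -/
theorem mem_valuationSubring_of_model (ha : ∀ i, a i ∈ M) (hcγM : cγ ∈ M) (hcγ0 : cγ ≠ 0)
    (hArch : ∀ μ ∈ M, μ ∉ V → ∀ ν ∈ M, ∃ n : ℕ, ν * μ⁻¹ ^ n ∈ V)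
    (B : Subring Ω) (hMB : ∀ μ ∈ M, μ ∈ V → μ ∈ B) {x g : Ω} (hxB : x ∈ B) (hgB : g ∈ B)
    {e : ℕ} (he : e ≠ 0) (hgQ : g * cNorm V a i₀ cγ e = (∏ i, (x - a i)) ^ e)
    (W : ValuationSubring Ω) (hBW : B ≤ W.toSubring) :
    conjProd V.valuation a i₀ (V.valuation cγ) x ∈ W ∧
      conjProd V.valuation a i₀ (V.valuation cγ) x * (x - a i₀) / cγ ∈ W := by
  classical
  by_cases hcase : ∃ μ ∈ M, μ ∉ V ∧ μ ∈ W
  · -- `W` contains the constants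
    obtain ⟨μ, hμM, hμV, hμW⟩ := hcase
    have hμ0 : μ ≠ 0 := fun h0 => hμV (h0 ▸ V.zero_mem)
    have hMW : ∀ ν ∈ M, ν ∈ W := fun ν hν => by
      obtain ⟨n, hn⟩ := hArch μ hμM hμV ν hν
      have h1 : ν * μ⁻¹ ^ n ∈ W := hBW (hMB _ (M.mul_mem hν (M.pow_mem (M.inv_mem hμM) n)) hn)
      have h2 : ν = (ν * μ⁻¹ ^ n) * μ ^ n := by
        rw [mul_assoc, ← mul_pow, inv_mul_cancel₀ hμ0, one_pow, mul_one]
      rw [h2]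
      exact W.toSubring.mul_mem h1 (W.toSubring.pow_mem hμW n)
    have hxW : x ∈ W := hBW hxB
    have hb : conjProd V.valuation a i₀ (V.valuation cγ) x ∈ W := by
      rw [conjProd]
      refine W.toSubring.prod_mem fun i hi => ?_
      rw [div_eq_mul_inv]
      exact W.toSubring.mul_mem (W.toSubring.sub_mem hxW (hMW _ (ha i)))
        (hMW _ (M.inv_mem (M.sub_mem (ha i₀) (ha i))))
    refine ⟨hb, ?_⟩
    rw [div_eq_mul_inv]
    exact W.toSubring.mul_mem (W.toSubring.mul_mem hb (W.toSubring.sub_mem hxW (hMW _ (ha i₀))))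
      (hMW _ (M.inv_mem hcγM))
  · -- `W ∩ M = M ∩ V`: transfer near/far and the `Q`-bound, then apply the estimate
    push Not at hcase
    have htr : ∀ μ ∈ M, μ ∈ W ↔ μ ∈ V := fun μ hμ =>
      ⟨fun h => by_contra fun hV => hcase μ hμ hV h, fun h => hBW (hMB μ hμ h)⟩
    have hord : ∀ {μ ν : Ω}, μ ∈ M → ν ∈ M →
        (W.valuation μ ≤ W.valuation ν ↔ V.valuation μ ≤ V.valuation ν) :=
      fun hμ hν => valuation_le_iff_of_trace_eq htr hμ hν
    have hfar : far W.valuation a i₀ (W.valuation cγ) = far V.valuation a i₀ (V.valuation cγ) := by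
      ext i
      rw [mem_far, mem_far, ← not_le, ← not_le, hord (M.sub_mem (ha i) (ha i₀)) hcγM]
    have hnear : near W.valuation a i₀ (W.valuation cγ) = near V.valuation a i₀ (V.valuation cγ) := by
      ext i
      rw [mem_near, mem_near, hord (M.sub_mem (ha i) (ha i₀)) hcγM]
    have hconj : conjProd W.valuation a i₀ (W.valuation cγ) x = conjProd V.valuation a i₀ (V.valuation cγ) x := by
      rw [conjProd, conjProd, hfar]
    -- the `Q`-bound for `W`
    have hQ : QBound W.valuation a i₀ (W.valuation cγ) x := by
      have h1 := congrArg W.valuation hgQ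
      rw [map_mul, map_pow, map_prod] at h1
      have hg1 : W.valuation g ≤ 1 := (W.valuation_le_one_iff _).mpr (hBW hgB)
      have h2 : (∏ i, W.valuation (x - a i)) ^ e ≤ W.valuation (cNorm V a i₀ cγ e) := by
        rw [← h1]
        calc W.valuation g * W.valuation (cNorm V a i₀ cγ e)
            ≤ 1 * W.valuation (cNorm V a i₀ cγ e) := mul_le_mul' hg1 le_rfl
          _ = _ := one_mul _
      rw [cNorm, map_pow, map_mul, map_pow, map_prod, ← hnear, ← hfar] at h2
      exact le_of_pow_le_pow_left₀ he zero_le h2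
    constructor
    · rw [← W.valuation_le_one_iff, ← hconj]
      exact valuation_conjProd_le_one hQ
    · rw [← W.valuation_le_one_iff, map_div₀, div_le_one₀ ((W.valuation.pos_iff).mpr hcγ0), ← hconj]
      exact valuation_conjProd_mul_sub_le hQ

/-- **Integrality of the separating function over the model.** [folklore] -/
theorem isIntegral_conjProd_of_model (ha : ∀ i, a i ∈ M) (hcγM : cγ ∈ M) (hcγ0 : cγ ≠ 0)
    (hArch : ∀ μ ∈ M, μ ∉ V → ∀ ν ∈ M, ∃ n : ℕ, ν * μ⁻¹ ^ n ∈ V)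
    (B : Subring Ω) (hMB : ∀ μ ∈ M, μ ∈ V → μ ∈ B) {x g : Ω} (hxB : x ∈ B) (hgB : g ∈ B)
    {e : ℕ} (he : e ≠ 0) (hgQ : g * cNorm V a i₀ cγ e = (∏ i, (x - a i)) ^ e) :
    IsIntegral B (conjProd V.valuation a i₀ (V.valuation cγ) x) ∧
      IsIntegral B (conjProd V.valuation a i₀ (V.valuation cγ) x * (x - a i₀) / cγ) := by
  have key : ∀ z : Ω, (∀ W : ValuationSubring Ω, B ≤ W.toSubring → z ∈ W) → IsIntegral B z := by
    intro z hz
    have hmem : z ∈ (⨅ W : {W : ValuationSubring Ω // (B : Set Ω) ⊆ W.toSubring}, W.1.toSubring) :=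
      Subring.mem_iInf.mpr fun W => hz W.1 (fun b hb => W.2 hb)
    rw [iInf_valuationSubring_superset] at hmem
    have h1 : IsIntegral (Subring.closure (B : Set Ω)) z := hmem
    rw [Subring.closure_eq] at h1
    exact h1
  exact ⟨key _ fun W hW => (mem_valuationSubring_of_model V M a i₀ cγ ha hcγM hcγ0 hArch B hMB hxB hgB he hgQ W hW).1,
    key _ fun W hW => (mem_valuationSubring_of_model V M a i₀ cγ ha hcγM hcγ0 hArch B hMB hxB hgB he hgQ W hW).2⟩

end ConjugateDiscs

end Literature.AlgebraicGeometry.Resolution
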